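import Summits.Ventures.FusionMHD.Bench.SolovevPCFNstxMercierMidThreshold
import Summits.Ventures.FusionMHD.Bench.SolovevPCFNstxResistiveMidData
import Summits.Ventures.FusionMHD.Bench.SolovevPCFResistiveClosedForm
import Summits.Ventures.FusionMHD.Models.SolovevPCFResistiveIndex
import HarnessLib

/-!
# F1.DR — the resistive-interchange index `D_R` of the INTERIOR flux surface `ρ/ρ_e = 1/2` (Lee–Cerfon label `r = a/2 = ε/(2R_a)`)
# of the NSTX-like PCF Solov'ev equilibrium: atoms, `⟨B²⟩`, and the identity `resistiveIndex = DRAtoms.DR` of the shared closed form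
(venture LADDER-GRIDFUSION, rung F1 sub-rung F1.DR, «F1.DR-PROFILE» extension of the edge rows #63/#64 to the interior surfaces whose
Mercier-profile inputs are of record (#20/#21 «F1.MERCIER-MID», sos-6); cell `gridfusion`, seat `gridfusion-model-7` (g0),
2026-08-27.  Inputs BY NAME: sos-6's `…MercierMid{Data1,2,3,Subst,Integrals,Threshold}` (atomic integrals `K1m…K8m`, dictionary `lcU_theta`/
`lcGradSq_theta`/`lcAvgWeight_mid`, brackets `A4m/A6m/A7m/phihatm/M2m/M0m`, `lcMidData`, `mercierF_lcMidData`); model-5's `NstxLike.avgBsq_eq` /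
`resistiveIndex_eq_mercierD` (p492374); this seat's `K9m` certificate (`…ResistiveMidData`) and closed-form algebra (`…ResistiveClosedForm`).)

## The statement (three columns, never merged)
CERTIFIED (kernel, this file), MID-RADIUS surface of the NSTX-like instance, free constant `g = F > 0`:
* `integral_gradSq_w_div_u_mid`: `∫₀^{2π} |∇Ψ|²·w/u dt = (4αρ²κ₀/c)·K9m`; `A9m = ⟨B_p²⟩ = 4αρ²K9m/K1m ∈ [0.0594687147379, 0.059468714738]`;
  `avgBsq_mid`: `⟨B²⟩ = g²·A4m + A9m`;
* field identities of model-5's record `lcMidData g`: `Φ″ = g·phihatm·V′` (`Phi''_mid`), `⟨B²/G⟩ = g²A7m + A4m` (`gB2_mid`),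
  `⟨σB²/G⟩ = g·A6m` (`gsB2_mid`);
* **`resistiveIndex_mid_eq`: `NstxLike.resistiveIndex g (ε/(2R_a)) = midAtoms.DR g`** with `midAtoms = ⟨A4m, A6m, A7m, A9m, π·phihatm, M2m, M0m⟩`,
  i.e. `D_R(g) = −(M2m − M0m/g²)/(4π²phihatm²) + (H − 1/2)²`, `H = ((g²A7m + A4m)/(g²A4m + A9m) − A6m)/(2π·phihatm)`;
* the two structural sign conditions `A4m² < A7m·A9m`, `X < 0` and hence **`D_R` strictly decreasing in `g` on `(0, ∞)`** on this surface
  (`resistiveIndex_mid_strictAntiOn`); brackets `piPhihatm_bounds`, `Sm_bounds` for the threshold file.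
LABEL «RESISTIVE-INTERCHANGE INDEX SIGN (criterion as printed, Zheng (3.42) / GGJ 1975) — not a tearing / resistive-wall statement».
MODELLED: ANALYTIC PCF Solov'ev equilibrium (ideal MHD, `μ₀p′ = −1`, `FF′ = 0`, fixed boundary; «NSTX-like» = printed shape triple of
[cite: PatakiCerfonFreidberg2013, §6.1], not NSTX); GGJ resistive-layer index evaluated on ideal-equilibrium inputs; `F` free; nothing here
says any plasma or device is stable.  VALIDATED (box B candidates, not used): model-5 `bench/F1DR-validated-lineageB.json` d2ab886dc86d0018
(interior-surface values where tabulated); model-7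
`cert/model-7/dr_check.py`.  No `decide` here (the enclosures are the imported Data files').
-/

noncomputable section

open Real MeasureTheory Set intervalIntegral
open Literature.Analysis.ValidatedNumerics Literature.Analysis.ValidatedNumerics.PolyMP
open Literature.Analysis.ValidatedNumerics.ExpPoly (Poly)
open Literature.MathematicalPhysics.MHD Literature.MathematicalPhysics.MHD.Solovev
open Literature.MathematicalPhysics.MHD.Mercier.FluxForm
open Summit.Ventures.FusionMHD.Models.SolovevPCF
open Summit.Ventures.FusionMHD.Bench.ResistiveClosedForm

namespace Summit.Ventures.FusionMHD.Bench.SolovevPCFNstx.MercierMid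

open Summit.Ventures.FusionMHD.Bench.SolovevPCFIter.MercierEdge (theta integral_zero_two_pi_eq_theta eval_const_two
  sqrt_two_sub_pos uIcc01)
open Summit.Ventures.FusionMHD.Bench.SolovevPCFNstx.MercierEdge (kappa0_eq_div sqrt_q0Sq_eq lcAmp_eq csLC_edge d3alpha)

/-! ## §1 The one new atomic `t`-integral on the mid-radius loop -/

section atomic

variable {g : ℝ} (hg : 0 < g)
include hg

/-- Continuity of `G·w/u` on the mid-radius loop. [folklore] -/
theorem continuous_gradSq_w_div_u_mid : Continuous fun t =>
      lcGradSq NstxLike.kappa0 g NstxLike.Ra (NstxLike.q0 g) (NstxLike.ε / NstxLike.Ra / 2) t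
        * lcAvgWeight NstxLike.kappa0 g NstxLike.Ra (NstxLike.q0 g) (NstxLike.ε / NstxLike.Ra / 2) t
        / lcU NstxLike.Ra (NstxLike.ε / NstxLike.Ra / 2) t :=
  (continuous_lcGradSq_mid.mul (continuous_w_mid hg)).div₀ continuous_lcU_mid fun t => (lcU_mid_pos t).ne'

/-- `T9` (mid-radius): **`∫₀^{2π} G·w/u dt = (κ₀·4αρ²/c)·K9m`**. [cite: Jardin2010, §5.3 eq. (5.30)] -/
theorem integral_gradSq_w_div_u_mid :
    ∫ t in (0 : ℝ)..(2 * π), lcGradSq NstxLike.kappa0 g NstxLike.Ra (NstxLike.q0 g) (NstxLike.ε / NstxLike.Ra / 2) t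
        * lcAvgWeight NstxLike.kappa0 g NstxLike.Ra (NstxLike.q0 g) (NstxLike.ε / NstxLike.Ra / 2) t
        / lcU NstxLike.Ra (NstxLike.ε / NstxLike.Ra / 2) t
      = NstxLike.kappa0 * c4m / (1691292800 / 4215904879 : ℝ) * K9m := by
  have hg' := hg.ne'
  rw [integral_zero_two_pi_eq_theta _ (continuous_gradSq_w_div_u_mid hg)
    (fun t => by simp only [lcAvgWeight_mid hg', lcU_two_pi_sub, lcGradSq_two_pi_sub hg'])]
  have key : ∀ w ∈ uIcc (0:ℝ) 1,
      (lcGradSq NstxLike.kappa0 g NstxLike.Ra (NstxLike.q0 g) (NstxLike.ε / NstxLike.Ra / 2) (theta w)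
          * lcAvgWeight NstxLike.kappa0 g NstxLike.Ra (NstxLike.q0 g) (NstxLike.ε / NstxLike.Ra / 2) (theta w)
          / lcU NstxLike.Ra (NstxLike.ε / NstxLike.Ra / 2) (theta w)
        + lcGradSq NstxLike.kappa0 g NstxLike.Ra (NstxLike.q0 g) (NstxLike.ε / NstxLike.Ra / 2) (π - theta w)
          * lcAvgWeight NstxLike.kappa0 g NstxLike.Ra (NstxLike.q0 g) (NstxLike.ε / NstxLike.Ra / 2) (π - theta w)
          / lcU NstxLike.Ra (NstxLike.ε / NstxLike.Ra / 2) (π - theta w))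
        * (2 / Real.sqrt (2 - w ^ 2))
      = NstxLike.kappa0 * c4m / (2 * (1691292800 / 4215904879 : ℝ)) * (K9me.toFun w * Poly.eval [2] w) := by
    intro w hw
    rw [uIcc01] at hw
    rw [lcAvgWeight_mid hg', lcAvgWeight_mid hg', lcGradSq_theta hg' hw, lcGradSq_pi_sub_theta hg' hw,
      lcU_theta hw, lcU_pi_sub_theta hw, toFun_K9me, eval_const_two]
    have hP1 : PpMid w ≠ 0 := (PpMid_pos hw).ne'
    have hP2 : PmMid w ≠ 0 := (PmMid_pos hw).ne'
    have hU1 : UpMid w ≠ 0 := (UpMid_pos hw).ne'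
    have hU2 : UmMid w ≠ 0 := (UmMid_pos w).ne'
    have h3 : Real.sqrt (UpMid w) ≠ 0 := (Real.sqrt_pos.2 (UpMid_pos hw)).ne'
    have h4 : Real.sqrt (UmMid w) ≠ 0 := (Real.sqrt_pos.2 (UmMid_pos w)).ne'
    have h5 : Real.sqrt (2 - w ^ 2) ≠ 0 := (sqrt_two_sub_pos hw).ne'
    have hc4 : c4m ≠ 0 := c4m_pos.ne'
    field_simp
  rw [integral_congr key, intervalIntegral.integral_const_mul]
  unfold K9m
  ring

end atomic

/-! ## §2 `⟨B_p²⟩` and `⟨B²⟩` of the mid-radius surface -/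

/-- `A9m := ⟨B_p²⟩ = 4αρ²·K9m/K1m` of the mid-radius surface. [cite: Jardin2010, §5.3 eq. (5.30)] -/
def A9m : ℝ := c4m * K9m / K1m

/-- `A9m ∈ [0.0594687147379, 0.059468714738]` (width 10⁻¹³). [folklore] -/
theorem A9m_bounds : (594687147379 / 10000000000000 : ℝ) ≤ A9m ∧ A9m ≤ (29734357369 / 500000000000 : ℝ) := by
  obtain ⟨h1l, h1h⟩ := K1m_bounds; obtain ⟨h9l, h9h⟩ := K9m_bounds
  have hK1 := K1m_pos
  unfold A9m
  constructor
  · rw [le_div_iff₀ hK1]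
    calc (594687147379 / 10000000000000 : ℝ) * K1m
        ≤ (594687147379 / 10000000000000 : ℝ) * ((3147088042107370438622507/1208925819614629174706176 : ℚ) : ℝ) := by gcongr
      _ ≤ c4m * ((766796714537788022872571/1208925819614629174706176 : ℚ) : ℝ) := by unfold c4m; push_cast; norm_num
      _ ≤ c4m * K9m := by unfold c4m; gcongr
  · rw [div_le_iff₀ hK1]
    calc c4m * K9m ≤ c4m * ((766796714537788029062945/1208925819614629174706176 : ℚ) : ℝ) := by unfold c4m; gcongr
      _ ≤ (29734357369 / 500000000000 : ℝ) * ((3147088042107342143387543/1208925819614629174706176 : ℚ) : ℝ) := by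
          unfold c4m; push_cast; norm_num
      _ ≤ (29734357369 / 500000000000 : ℝ) * K1m := by gcongr

/-- `A9m > 0`, `A4m > 0`, `phihatm > 0`. [folklore] -/
theorem A9m_A4m_phihatm_pos : 0 < SolovevPCFNstx.MercierMid.A9m ∧ 0 < A4m ∧ 0 < phihatm :=
  ⟨lt_of_lt_of_le (by norm_num) A9m_bounds.1, lt_of_lt_of_le (by norm_num) A4m_bounds.1,
    lt_of_lt_of_le (by norm_num) phihatm_bounds.1⟩

/-- **`⟨B²⟩` of the mid-radius surface: `⟨B²⟩ = g²·A4m + A9m`** (model-5's `avgBsq_eq` with `T1`, `T6b`, `T9` of the mid chain).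
[cite: Jardin2010, §5.3 eq. (5.30)] -/
theorem avgBsq_mid {g : ℝ} (hg : 0 < g) : NstxLike.avgBsq g (NstxLike.ε / NstxLike.Ra / 2) = g ^ 2 * A4m + A9m := by
  rw [NstxLike.avgBsq_eq hg mid_minorRadius.1 mid_minorRadius.2, integral_w_div_u_mid hg, integral_w_mid hg,
    integral_gradSq_w_div_u_mid hg]
  unfold A4m A9m
  have hk := NstxLike.kappa0_pos
  have hK := K1m_pos
  have hc4 := c4m_pos
  field_simp

/-! ## §3 The record `lcMidData g` field by field (what the resistive index needs) -/

section fields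

variable {g : ℝ} (hg : 0 < g)
include hg

/-- `Φ″ = g·phihatm·V′` on the mid-radius record (`Φ″/V′ = −3q₀R_a²K3m/(2πκ₀rK1m)`, `arm = c·rR_a/2`). [cite: Jardin2010, §8.5 eq. (8.134)] -/
theorem Phi''_mid : (SolovevPCFNstx.MercierMid.lcMidData g).Φ'' = g * phihatm * (lcMidData g).V' := by
  obtain ⟨hr, h2r⟩ := mid_minorRadius
  unfold lcMidData phihatm
  rw [lcGGJData_Φ'' NstxLike.Ra_pos NstxLike.kappa0_pos hg (NstxLike.q0_pos hg) hr h2r,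
    lcGGJData_V' NstxLike.Ra_pos NstxLike.kappa0_pos hg (NstxLike.q0_pos hg) hr h2r,
    integral_qKernelDr_mid, integral_w_mid hg, lcAmp_eq hg.ne', NstxLike.q0_eq g hg.le, sqrt_q0Sq_eq, kappa0_eq_div]
  have hs : 0 < Real.sqrt d3alpha := Real.sqrt_pos.2 (by unfold MercierEdge.d3alpha; norm_num)
  have hR := NstxLike.Ra_pos
  have hπ := Real.pi_pos
  have hK := K1m_pos
  unfold arm NstxLike.ε
  field_simp
  ring

/-- `⟨B²/|∇Ψ|²⟩ = g²·A7m + A4m` on the mid-radius record. [cite: Jardin2010, §8.5 eq. (8.134)] -/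
theorem gB2_mid : (SolovevPCFNstx.MercierMid.lcMidData g).gB2 = g ^ 2 * A7m + A4m := by
  obtain ⟨hr, h2r⟩ := mid_minorRadius
  unfold lcMidData A7m A4m
  rw [lcGGJData_gB2 NstxLike.Ra_pos NstxLike.kappa0_pos hg (NstxLike.q0_pos hg) hr h2r, integral_w_mid hg]
  have hsplit : ∀ t, (g ^ 2 + lcGradSq NstxLike.kappa0 g NstxLike.Ra (NstxLike.q0 g) (NstxLike.ε / NstxLike.Ra / 2) t)
        / (lcU NstxLike.Ra (NstxLike.ε / NstxLike.Ra / 2) t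
            * lcGradSq NstxLike.kappa0 g NstxLike.Ra (NstxLike.q0 g) (NstxLike.ε / NstxLike.Ra / 2) t)
        * lcAvgWeight NstxLike.kappa0 g NstxLike.Ra (NstxLike.q0 g) (NstxLike.ε / NstxLike.Ra / 2) t
      = g ^ 2 * (lcAvgWeight NstxLike.kappa0 g NstxLike.Ra (NstxLike.q0 g) (NstxLike.ε / NstxLike.Ra / 2) t
          / (lcU NstxLike.Ra (NstxLike.ε / NstxLike.Ra / 2) t
              * lcGradSq NstxLike.kappa0 g NstxLike.Ra (NstxLike.q0 g) (NstxLike.ε / NstxLike.Ra / 2) t))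
        + lcAvgWeight NstxLike.kappa0 g NstxLike.Ra (NstxLike.q0 g) (NstxLike.ε / NstxLike.Ra / 2) t
          / lcU NstxLike.Ra (NstxLike.ε / NstxLike.Ra / 2) t := by
    intro t
    have hu := (lcU_mid_pos t).ne'
    have hG := (lcGradSq_mid_pos hg t).ne'
    set r₀ := NstxLike.ε / NstxLike.Ra / 2 with hr₀
    field_simp
  simp_rw [hsplit]
  rw [intervalIntegral.integral_add (((continuous_w_div_uG_mid hg).const_mul _).intervalIntegrable _ _)
    ((continuous_w_div_u_mid hg).intervalIntegrable _ _), intervalIntegral.integral_const_mul,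
    integral_w_div_uG_mid hg, integral_w_div_u_mid hg]
  have hk := NstxLike.kappa0_pos
  have hK := K1m_pos
  have hc4 := c4m_pos
  field_simp

/-- `⟨σB²/|∇Ψ|²⟩ = g·A6m` on the mid-radius record (`C_s = 1`). [cite: Jardin2010, §8.5 eq. (8.134)] -/
theorem gsB2_mid : (SolovevPCFNstx.MercierMid.lcMidData g).gσB2 = g * A6m := by
  obtain ⟨hr, h2r⟩ := mid_minorRadius
  unfold lcMidData A6m
  rw [lcGGJData_gσB2 NstxLike.Ra_pos NstxLike.kappa0_pos hg (NstxLike.q0_pos hg) hr h2r, integral_w_mid hg,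
    integral_w_div_G_mid hg, csLC_edge hg]
  have hk := NstxLike.kappa0_pos
  have hK := K1m_pos
  have hc4 := c4m_pos
  field_simp

end fields

/-! ## §4 The atoms of the surface and `resistiveIndex = DR` -/

/-- The seven certified atoms of the mid-radius surface: `⟨A4m, A6m, A7m, A9m, π·phihatm, M2m, M0m⟩`. [cite: Zheng2015, §3.2 eq. (3.42)] -/
def midAtoms : DRAtoms := ⟨A4m, A6m, A7m, A9m, π * phihatm, M2m, M0m⟩

/-- Positivity of the atoms used by the closed form: `A4m, A9m, π·phihatm > 0`. [folklore] -/
theorem midAtoms_pos : 0 < SolovevPCFNstx.MercierMid.midAtoms.A4 ∧ 0 < midAtoms.A9 ∧ 0 < midAtoms.P := by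
  obtain ⟨h9, h4, hph⟩ := A9m_A4m_phihatm_pos
  exact ⟨h4, h9, by show 0 < π * phihatm; positivity⟩

/-- `Φ″ ≠ 0` on the mid-radius record (positive shear). [cite: Jardin2010, §8.5 eq. (8.134)] -/
theorem ggjData_mid_Φ''_ne {g : ℝ} (hg : 0 < g) : (NstxLike.ggjData g (NstxLike.ε / NstxLike.Ra / 2)).Φ'' ≠ 0 := by
  show (lcMidData g).Φ'' ≠ 0
  rw [Phi''_mid hg]
  have hV : (lcMidData g).V' ≠ 0 :=
    lcGGJData_V'_ne NstxLike.Ra_pos NstxLike.kappa0_pos hg (NstxLike.q0_pos hg) mid_minorRadius.1 mid_minorRadius.2 _ _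
  have hph := A9m_A4m_phihatm_pos.2.2
  exact mul_ne_zero (mul_pos hg hph).ne' hV

/-- **model-5's `NstxLike.resistiveIndex` OF THE MID-RADIUS SURFACE EQUALS THE SHARED CLOSED FORM `midAtoms.DR g`** (`g > 0`).
[cite: Zheng2015, §3.2 eq. (3.42)] -/
theorem resistiveIndex_mid_eq {g : ℝ} (hg : 0 < g) : NstxLike.resistiveIndex g (NstxLike.ε / NstxLike.Ra / 2) = midAtoms.DR g := by
  have hΦ := ggjData_mid_Φ''_ne hg
  rw [NstxLike.resistiveIndex_eq_mercierD hg mid_minorRadius.1 mid_minorRadius.2 hΦ, avgBsq_mid hg]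
  change (lcMidData g).mercierD - 1 / 4
      + ((lcMidData g).V' * (lcMidData g).gB2 / (lcMidData g).shear
          * ((lcMidData g).gσB2 / (lcMidData g).gB2 - g / (g ^ 2 * A4m + A9m)) - 1 / 2) ^ 2 = midAtoms.DR g
  have hΨ2 : (lcMidData g).Ψ'' = 0 := rfl
  have hΨ1 : (lcMidData g).Ψ' = 2 * π := rfl
  have hV : (lcMidData g).V' ≠ 0 :=
    lcGGJData_V'_ne NstxLike.Ra_pos NstxLike.kappa0_pos hg (NstxLike.q0_pos hg) mid_minorRadius.1 mid_minorRadius.2 _ _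
  unfold SurfaceData.mercierD SurfaceData.shear
  rw [mercierF_lcMidData hg, Phi''_mid hg, hΨ1, hΨ2, gB2_mid hg, gsB2_mid hg]
  unfold midAtoms DRAtoms.DR DRAtoms.H DRAtoms.N DRAtoms.Dn
  obtain ⟨h9, h4, hph⟩ := A9m_A4m_phihatm_pos
  have hA7 : 0 < A7m := lt_of_lt_of_le (by norm_num) A7m_bounds.1
  have hπ := Real.pi_pos
  have hD : g ^ 2 * A4m + A9m ≠ 0 := by positivity
  have hN : g ^ 2 * A7m + A4m ≠ 0 := by positivity
  have hg' := hg.ne'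
  set V := (lcMidData g).V' with hVdef
  field_simp
  ring

/-! ## §5 The two structural sign conditions on this surface, the brackets, and monotonicity -/

/-- `π·phihat ∈ [1.81336261852, 1.81336261853]`. [folklore] -/
theorem piPhihatm_bounds : (45334065463 / 25000000000 : ℝ) ≤ π * phihatm ∧ π * phihatm ≤ (181336261853 / 100000000000 : ℝ) := by
  obtain ⟨hPl, hPh⟩ := phihatm_bounds
  have hpi1 := Real.pi_gt_d20
  have hpi2 := Real.pi_lt_d20
  constructor
  · calc (45334065463 / 25000000000 : ℝ) ≤ 3.14159265358979323846 * (72151406089 / 125000000000 : ℝ) := by norm_num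
      _ ≤ π * phihatm := mul_le_mul hpi1.le hPl (by norm_num) Real.pi_pos.le
  · calc π * phihatm ≤ 3.14159265358979323847 * (577211248713 / 1000000000000 : ℝ) :=
          mul_le_mul hpi2.le hPh (by linarith) (by norm_num)
      _ ≤ (181336261853 / 100000000000 : ℝ) := by norm_num

/-- `S = A6m + π·phihatm` bracket. [folklore] -/
theorem Sm_bounds : (9110642748567 / 500000000000 : ℝ) ≤ midAtoms.A6 + midAtoms.P
    ∧ midAtoms.A6 + midAtoms.P ≤ (18221285497311 / 1000000000000 : ℝ) := by
  obtain ⟨h6l, h6h⟩ := A6m_bounds; obtain ⟨hPl, hPh⟩ := piPhihatm_bounds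
  show _ ≤ A6m + π * phihatm ∧ A6m + π * phihatm ≤ _
  constructor <;> linarith

/-- `A4m² < A7m·A9m` on the mid-radius surface. [folklore] -/
theorem A4m_sq_lt : SolovevPCFNstx.MercierMid.midAtoms.A4 ^ 2 < midAtoms.A7 * midAtoms.A9 := by
  show A4m ^ 2 < A7m * A9m
  obtain ⟨hA4l, hA4h⟩ := A4m_bounds; obtain ⟨hA7l, hA7h⟩ := A7m_bounds; obtain ⟨hA9l, hA9h⟩ := A9m_bounds
  have h1 : (13459169990339 / 1000000000000 : ℝ) * (594687147379 / 10000000000000 : ℝ) ≤ A7m * A9m :=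
    mul_le_mul hA7l hA9l (by norm_num) (le_trans (by norm_num) hA7l)
  have h2 : A4m ^ 2 ≤ (380741137617 / 500000000000 : ℝ) ^ 2 := pow_le_pow_left₀ (le_trans (by norm_num) hA4l) hA4h 2
  have h3 : (380741137617 / 500000000000 : ℝ) ^ 2 < (13459169990339 / 1000000000000 : ℝ) * (594687147379 / 10000000000000 : ℝ) := by
    norm_num
  linarith

/-- `X(g) < 0` for every `g` on the mid-radius surface (`A7m < S·A4m`, `A4m < S·A9m`). [folklore] -/
theorem Xm_neg (g : ℝ) : SolovevPCFNstx.MercierMid.midAtoms.X g < 0 := by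
  obtain ⟨hA4l, hA4h⟩ := A4m_bounds; obtain ⟨hA7l, hA7h⟩ := A7m_bounds; obtain ⟨hA9l, hA9h⟩ := A9m_bounds
  obtain ⟨hSl, hSh⟩ := Sm_bounds
  have h1 : (9110642748567 / 500000000000 : ℝ) * (761482275233 / 1000000000000 : ℝ)
      ≤ (midAtoms.A6 + midAtoms.P) * A4m := mul_le_mul hSl hA4l (by norm_num) (le_trans (by norm_num) hSl)
  have h2 : (9110642748567 / 500000000000 : ℝ) * (594687147379 / 10000000000000 : ℝ)
      ≤ (midAtoms.A6 + midAtoms.P) * A9m := mul_le_mul hSl hA9l (by norm_num) (le_trans (by norm_num) hSl)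
  refine DRAtoms.X_neg_of ?_ ?_ g
  · show A7m < (midAtoms.A6 + midAtoms.P) * A4m; linarith
  · show A4m < (midAtoms.A6 + midAtoms.P) * A9m; linarith

/-- **`D_R` of the mid-radius surface is STRICTLY DECREASING in `g` on `(0, ∞)`** (closed form). [cite: Zheng2015, §3.2 eq. (3.42)] -/
theorem DRm_strictAntiOn : StrictAntiOn SolovevPCFNstx.MercierMid.midAtoms.DR (Set.Ioi 0) := by
  obtain ⟨h4, h9, hP⟩ := midAtoms_pos
  have hM0 : 0 < midAtoms.M0 := by show 0 < M0m; exact lt_of_lt_of_le (by norm_num) M0m_bounds.1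
  exact DRAtoms.DR_strictAntiOn_of h4 h9 hP hM0 A4m_sq_lt Xm_neg

/-- **model-5's `resistiveIndex` of the mid-radius surface is strictly decreasing in the free constant on `(0, ∞)`.**
[cite: Zheng2015, §3.2 eq. (3.42)] -/
theorem resistiveIndex_mid_strictAntiOn :
    StrictAntiOn (fun g => NstxLike.resistiveIndex g (NstxLike.ε / NstxLike.Ra / 2)) (Set.Ioi 0) := by
  intro g₁ h₁ g₂ h₂ hlt
  show NstxLike.resistiveIndex g₂ (NstxLike.ε / NstxLike.Ra / 2) < NstxLike.resistiveIndex g₁ (NstxLike.ε / NstxLike.Ra / 2)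
  rw [resistiveIndex_mid_eq (show 0 < g₁ from h₁), resistiveIndex_mid_eq (show 0 < g₂ from h₂)]
  exact DRm_strictAntiOn h₁ h₂ hlt

end Summit.Ventures.FusionMHD.Bench.SolovevPCFNstx.MercierMid

end
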